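import Summits.NavierStokesRegularity.NavierStokesRegularity.Theorems.StableStrataDoorInstances
import Summits.NavierStokesRegularity.NavierStokesRegularity.Theorems.StableStrataDoorOneSliceAxiSeq
import Summits.NavierStokesRegularity.NavierStokesRegularity.Theorems.StableStrataDoorAlongTimes
import Literature.Analysis.FluidPDE.GigaMiura2011UnidirectionalVorticityHolds
import Summits.NavierStokesRegularity.NavierStokesRegularity.Theorems.LocalSineTubeDoorProfileAlignedWindowRigidity
import Literature.Analysis.FluidPDE.DifferentiableGaussGreen
import Mathlib.Analysis.Distribution.AEEqOfIntegralContDiff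
import Literature.Analysis.FluidPDE.LeiZhang2011Proofs
import Summits.NavierStokesRegularity.FluidComputer.RotatingBeltramiDrift

/-!
# SineMomentDoor — S27 «SineMomentDoor» (ROUND-26 of the ns-regularity-ideate cell, seat p1 g22): the ε-OPEN form of
vorticity-DIRECTION COHERENCE (Constantin–Fefferman / Giga–Miura) on ONE similarity window, as an INSTANCE of the
landed S26 schema `StableStrataDoorSchema` (K-stab(Φ, 𝔖): zoom-closed observable + analytic spread + stratum Liouville
⇒ an `ε(ν, M, U)`-door), with NO change to the schema.

THE OBSERVABLE (zero order, weak, sign-blind).  For a window `U ⊂ ℝ³` (open, bounded, nonempty) the TEST WEIGHTS are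
`𝒯(U) = {g ∈ C^∞_c(U; ℝ) : |g| ≤ 1, ‖Dg‖ ≤ 1}`; the **vorticity moment** of a slice field `F` against `g` is the weak
integral `m(g, F) = ∫ F × ∇g` (`= ∫ g · curl F` for `F ∈ C¹`, tree IBP
`integral_mul_inner_eq_integral_inner_cross_gradient`).  On the scale-normalised velocity
`F_t(ζ) = √(T−t) u(t, x₀ + √(T−t) ζ)` this is `m(g, F_t) = ∫ g(ζ) Ω_t(ζ) dζ`, `Ω_t(ζ) = (T−t) ω(t, x₀ + √(T−t) ζ)` the
scale-normalised VORTICITY.  The **sine-moment defect** is `sup_{g,h ∈ 𝒯(U)} ‖m(g, F) × m(h, F)‖`: it vanishes iff all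
window-averaged vorticity vectors are PARALLEL (a common direction `±e`, sign-blind = the CF «sine» of averaged
vorticities), and it is `ε`-small on every field whose vorticity directions on the window lie in an `O(ε)`-double-cone —
but also on fields with wildly oscillating directions whose averages cohere.

THE DOOR T-sine (`TargetSineMoment`, PROVED below modulo nothing: `targetSineMoment_holds`): for every `ν > 0`, `M` and
window `U` there is `ε = ε(ν, M, U) > 0` such that NO classical Leray–Hopf solution has a first singular point `(x₀, T)`
with space–time local Type I (constant `M`) at which the sine-moment defect of the scale-normalised velocity on the
window `U` is EVENTUALLY `≤ ε` as `t ↑ T`.  Equivalently: near a local Type-I singularity the window-averaged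
vorticity directions `m(g, F_t)/‖m(g, F_t)‖`, `g ∈ 𝒯(U)`, keep failing to be `ε`-coplanar-free… precisely: for `t ↑ T`
there are always two test weights whose vorticity moments span a parallelogram of area `> ε`.

WHY IT IS THE ε-OPEN UPGRADE.  The tree's direction doors are all EXACT-IN-THE-LIMIT: `LocalSineTubeDoor.Target`
(sup of the sine over pairs in the window → 0 along times, PROVED), `LocalOneDirectionTubeDoor.Target` (`∂_e u` fades),
S24 `DirectionEchoDoor` (two-time echo fades), Giga–Miura 2011 (continuous-alignment MODULUS `η`, tree
`gigaMiura2011_local_continuousAlignment_typeI_holds`).  Here `ε` is FIXED before the solution and never tends to `0`: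
the profile may sit at sine-moment distance `ε/2` from the unidirectional-vorticity stratum for all time — the schema's
compactness-and-rigidity argument (`stratumResidue_of_liouville`) excludes it anyway.

THE THREE SCHEMA HYPOTHESES, all PROVED here for `Φ = sinePhi U B` (`B = |M|/√ν + 1` a sup-cap that the local Type-I
bound discharges on physical window fields) and `𝔖 = uniStratum = {F | ∃ e ≠ 0, curl F × e ≡ 0}`:
(H1) `isWindowLsc_sinePhi` — dominated convergence of the cap-truncated moments under pointwise limits of continuous
fields (the cap makes the integrands uniformly dominated; an over-cap limit is penalised `⊤` and the penalty is open);
(H2) `spreadsTo_sinePhi` — zero defect ⇒ all moments parallel ⇒ (weak lemma, `IsOpen.ae_eq_zero_of_integral_contDiff_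
smul_eq_zero`) `curl F` pairwise parallel on `U` ⇒ aligned with one `e ≠ 0` on `U` ⇒ (slice analyticity, tree
`cross_eq_zero_spread`) on `ℝ³`; (H3) `stratumLiouville_uni` — the tree's `eq_zero_of_aligned_window` (LocalSineTubeDoor
2C: a Type-I ancient mild solution with one aligned slice is `0`).

THE LEGIBLE COROLLARY T-transverse (`TargetTransverseVorticity`, PROVED: `targetTransverseVorticity_holds`, §6): for
every `ν > 0`, `M`, `U` there is `δ = δ(ν, M, U) > 0` such that local Type I (constant `M`) at `(x₀, T)` together with
— for all `t` near `T⁻`, SOME unit axis `e_t` (free to rotate in time) — TRANSVERSE WINDOW VORTICITY MASS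
`∫_U ‖Ω_t × e_t‖ ≤ δ` forces backward boundedness at `(x₀, T)`: «δ-unidirectional scale-normalised vorticity on one
similarity window excludes local Type-I blow-up», `δ` FIXED, no modulus, no threshold, no two-point comparison
(`‖Ω × e‖ = ‖Ω‖ sin∠(Ω, ±e)` is the Constantin–Fefferman sine against the axis, weighted by vorticity size).  Proof:
`‖a × b‖ ≤ ‖b‖‖a × e‖ + ‖a‖‖b × e‖` for unit `e` + `‖m(g, F_t)‖ ≤ cap·vol(U)` (velocity cap, no vorticity budget
needed) + `‖m(g, F_t) × e‖ ≤ ∫_U ‖Ω_t × e‖` ⇒ sine-moment defect `≤ 2·cap·vol(U)·δ ≤ ε`.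

THE SEQUENTIAL UPGRADE T-transverse-seq (`TargetTransverseVorticitySeq`, PROVED UNCONDITIONALLY:
`targetTransverseVorticitySeq_holds`, §7): the same `δ(ν, M, U)`-hypothesis along SOME sequence `tₙ → T⁻` (axes `eₙ` free)
already forces backward boundedness — equivalently, at a local Type-I singularity the scale-normalised vorticity is, for ALL
late times, not `δ`-unidirectional on `U` against ANY axis.  Inputs: the landed sequential schema
`StableStrataDoorOneSliceSeqDoor.seqDoorAt_of_liouville`, the cell's I1 `StableStrataDoorAlongTimes.localPointZoomAlongTimesM_holds`
(landed 2026-08-28), and the ONE-SLICE LIOUVILLE THEOREM FOR THE UNIDIRECTIONAL STRATUM `oneSliceLiouville_uni` (PROVED here,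
kinematic: a Type-I-decaying classical slice with vorticity parallel to one direction is translation invariant along it —
tree `translationInvariant_of_curl_parallel`, Giga–Miura Prop. 2.2 step 1 — hence zero by decay along the line; then
one-slice uniqueness `eq_of_eq_slice_classical`).

WHAT THIS IS NOT.  Not a Type-I exclusion (the door is the OPEN NEIGHBOURHOOD of the unidirectional stratum in the
sine-moment topology, nothing more); not Constantin–Fefferman (no Lipschitz modulus, no `∫|ω||∇u|` budget) and not
Giga–Miura (no modulus `η`, no threshold `d`, one bounded window instead of `ℝ³`); not pointwise: the observable is
blind to direction oscillations that average out (a field whose window-averaged vorticities all vanish has defect `0`: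
then (H2) forces `curl F ≡ 0` on `U` for the PROFILE, which the Liouville step still kills — tree
`gigaMiura2011_curl_not_identically_zero_of_typeI` in window form).

LANDING NOTE (DIRECTOR-NS #88/#89, typer g20): this is nsreg-p1 g22's ROUND-26 door file `r26/Sketch27.lean`
(sha16 b3e45f4d288a9931; farm rc 0, 0 sorry), landed VERBATIM as four theorems files split along its section
boundaries — `SineMomentDoorDefs` (§0, §1, §0′), `SineMomentDoorSpread` (§2–§4), `SineMomentDoorDoors` (§5–§6),
`SineMomentDoorSeq` (§7).
-/

noncomputable section

open MeasureTheory Set Function Filter Topology TopologicalSpace Metric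
open scoped RealInnerProductSpace NNReal ENNReal Topology Pointwise ContDiff
open Literature.Analysis Literature.Analysis.FluidPDE
open Summit.NavierStokesRegularity.NavierStokesRegularity.Theorems.PoloidalWindowDoorPoloidalWindowRigidityWindow
open Summit.NavierStokesRegularity.NavierStokesRegularity.Theorems.ZoomReturnDoorDefs
open Summit.NavierStokesRegularity.NavierStokesRegularity.Theorems.StableStrataDoorDefs
open Summit.NavierStokesRegularity.NavierStokesRegularity.Theorems.StableStrataDoorWindowLimit
open Summit.NavierStokesRegularity.NavierStokesRegularity.Theorems.StableStrataDoorSchema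
open Summit.NavierStokesRegularity.NavierStokesRegularity.Theorems.StableStrataDoorInstances
open Summit.NavierStokesRegularity.NavierStokesRegularity.Theorems.LocalSineTubeDoorProfileAlignedWindowRigidity
open Summit.NavierStokesRegularity.NavierStokesRegularity.Theorems.LocalSineTubeDoorProfileAlignedWindowRigidityPlanarity

set_option linter.dupNamespace false

namespace Summit.NavierStokesRegularity.NavierStokesRegularity.Theorems.SineMomentDoor

/-! ## §0 The observable -/

/-- window TEST WEIGHTS `𝒯(U)`: smooth, compactly supported in `U`, `|g| ≤ 1`, `‖Dg‖ ≤ 1`. -/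
def IsTestWeight (U : Set (EuclideanSpace ℝ (Fin 3))) (g : EuclideanSpace ℝ (Fin 3) → ℝ) : Prop :=
  ContDiff ℝ ∞ g ∧ HasCompactSupport g ∧ tsupport g ⊆ U ∧ ∀ x, |g x| ≤ 1 ∧ ‖fderiv ℝ g x‖ ≤ 1

/-- the **vorticity moment** of the slice field `F` against the weight `g`, in weak form: `m(g, F) = ∫ F × ∇g`
(`= ∫ g · curl F` for `F ∈ C¹`, `inner_vortMoment`). -/
def vortMoment (g : EuclideanSpace ℝ (Fin 3) → ℝ) (F : EuclideanSpace ℝ (Fin 3) → EuclideanSpace ℝ (Fin 3)) :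
    EuclideanSpace ℝ (Fin 3) :=
  ∫ x, cross (F x) (gradient g x)

/-- radial truncation of a vector at level `B`: `a ↦ (B / max B ‖a‖) a` (identity on `‖a‖ ≤ B`, norm `≤ B`). -/
def truncate (B : ℝ) (a : EuclideanSpace ℝ (Fin 3)) : EuclideanSpace ℝ (Fin 3) := (B / max B ‖a‖) • a

/-- the cap-truncated moment `∫ trunc_B(F) × ∇g` (equal to `vortMoment g F` whenever `‖F‖ ≤ B` on `tsupport g`). -/
def truncMoment (B : ℝ) (g : EuclideanSpace ℝ (Fin 3) → ℝ) (F : EuclideanSpace ℝ (Fin 3) → EuclideanSpace ℝ (Fin 3)) :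
    EuclideanSpace ℝ (Fin 3) :=
  ∫ x, cross (truncate B (F x)) (gradient g x)

open Classical in
/-- the sup-cap penalty: `0` if `‖F‖ ≤ B` on `closure U`, else `⊤`. -/
def capPenalty (U : Set (EuclideanSpace ℝ (Fin 3))) (B : ℝ) (F : EuclideanSpace ℝ (Fin 3) → EuclideanSpace ℝ (Fin 3)) : ℝ≥0∞ :=
  if ∀ ζ ∈ closure U, ‖F ζ‖ ≤ B then 0 else ⊤

/-- **the sine-moment defect** `Φ_sine(U, B)(F) = cap penalty + sup_{g,h ∈ 𝒯(U)} ‖m_B(g, F) × m_B(h, F)‖`. -/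
def sinePhi (U : Set (EuclideanSpace ℝ (Fin 3))) (B : ℝ) (F : EuclideanSpace ℝ (Fin 3) → EuclideanSpace ℝ (Fin 3)) : ℝ≥0∞ :=
  capPenalty U B F +
    ⨆ (g : EuclideanSpace ℝ (Fin 3) → ℝ) (h : EuclideanSpace ℝ (Fin 3) → ℝ) (_ : IsTestWeight U g) (_ : IsTestWeight U h),
      ENNReal.ofReal ‖cross (truncMoment B g F) (truncMoment B h F)‖

/-- **the stratum: UNIDIRECTIONAL VORTICITY** — slice fields whose curl is everywhere parallel to one `e ≠ 0`. -/
def uniStratum : Set (EuclideanSpace ℝ (Fin 3) → EuclideanSpace ℝ (Fin 3)) :=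
  {F | ∃ e : EuclideanSpace ℝ (Fin 3), e ≠ 0 ∧ ∀ x, cross (curl F x) e = 0}

/-- the cap attached to the constants `(ν, M)`: `B = |M|/√ν + 1`. -/
def cap (ν M : ℝ) : ℝ := |M| / Real.sqrt ν + 1

/-- the cap is positive. -/
theorem cap_pos (ν M : ℝ) : 0 < cap ν M := by
  unfold cap; positivity

/-! ## §1 The texts of S27 -/

/-- **door T-sine · `TargetSineMoment` (PROVED: `targetSineMoment_holds`).**  For every `ν > 0`, `M` and every open
bounded nonempty window `U` there is `ε > 0` (fixed before the solution) such that: a classical Leray–Hopf solution on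
`[0, T)` with rapidly decaying data, space–time local Type I with constant `M` in a parabolic cylinder at `(x₀, T)`, whose
scale-normalised velocity `F_t = √(T−t) u(t, x₀ + √(T−t)·)` has, for all `t` close to `T⁻`, PAIRWISE `ε`-PARALLEL
WINDOW VORTICITY MOMENTS — `‖m(g, F_t) × m(h, F_t)‖ ≤ ε` for all `g, h ∈ 𝒯(U)`, `m(g, F_t) = ∫ g Ω_t`,
`Ω_t(ζ) = (T−t) ω(t, x₀ + √(T−t) ζ)` — is backward bounded at `(x₀, T)` (no singularity there). -/
def TargetSineMoment : Prop :=
  ∀ (ν M : ℝ) (U : Set (EuclideanSpace ℝ (Fin 3))), 0 < ν → IsOpen U → Bornology.IsBounded U → U.Nonempty →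
    ∃ ε : ℝ, 0 < ε ∧ ∀ (T : ℝ), 0 < T →
    ∀ (u : ℝ → EuclideanSpace ℝ (Fin 3) → EuclideanSpace ℝ (Fin 3)) (p : ℝ → EuclideanSpace ℝ (Fin 3) → ℝ),
    IsClassicalNSSolutionOn (Set.Ico 0 T) ν 0 u p → IsLerayHopfOn T ν 0 (u 0) u → HasRapidSpatialDecay (u 0) →
    ∀ (x₀ : EuclideanSpace ℝ (Fin 3)) (ρ : ℝ), 0 < ρ →
    (∀ t ∈ Set.Ico 0 T, T - ρ ^ 2 < t → ∀ x ∈ Metric.ball x₀ ρ, ‖u t x‖ * (‖x - x₀‖ + Real.sqrt (ν * (T - t))) ≤ M) →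
    (∀ᶠ t in nhdsWithin T (Set.Iio T), ∀ g h : EuclideanSpace ℝ (Fin 3) → ℝ, IsTestWeight U g → IsTestWeight U h →
      ‖cross (vortMoment g (physWindowField T x₀ u t)) (vortMoment h (physWindowField T x₀ u t))‖ ≤ ε) →
    IsBackwardBoundedAt u T x₀

/-- **schema form · `TargetSineSchema` (PROVED: `targetSineSchema_holds`)**: the S26 `ε`-door `StratumDoorAt` for the
observable `sinePhi U (cap ν M)` at every `(ν, M)`, `ν > 0`, and every open nonempty window. -/
def TargetSineSchema : Prop :=
  ∀ (ν M : ℝ) (U : Set (EuclideanSpace ℝ (Fin 3))), 0 < ν → IsOpen U → U.Nonempty →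
    StratumDoorAt (sinePhi U (cap ν M)) ν M

/-- **residue R-sine · `SineStableStratum` (PROVED: `sineStableStratum_holds`)**: the unidirectional-vorticity stratum is
`ε`-STABLE among Type-I profiles in the sine-moment topology — for every `ν > 0`, `D`, `B > 0` and open nonempty `U`
(`D > 0`) there is `ε > 0` such that a classical solution on `(−∞,0) × ℝ³` with `|V| ≤ D/(|x| + √−t)` whose profile window fields
have sine-moment defect `≤ ε` at every profile time is `0`. -/
def SineStableStratum : Prop :=
  ∀ (ν D B : ℝ) (U : Set (EuclideanSpace ℝ (Fin 3))), 0 < ν → 0 < D → 0 < B → IsOpen U → U.Nonempty →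
    StratumResidue (sinePhi U B) ν D

/-! ## §0′ Elementary facts: cross product, truncation, test weights -/

/-- anticommutativity of the cross product on `EuclideanSpace ℝ (Fin 3)`. -/
theorem cross_comm_neg (a b : EuclideanSpace ℝ (Fin 3)) : cross b a = -cross a b := by
  show WithLp.toLp 2 (crossProduct b.ofLp a.ofLp) = -WithLp.toLp 2 (crossProduct a.ofLp b.ofLp)
  rw [← cross_anticomm a.ofLp b.ofLp, WithLp.toLp_neg]

/-- `a × b = 0 ⇒ b × a = 0`. -/
theorem cross_eq_zero_symm {a b : EuclideanSpace ℝ (Fin 3)} (h : cross a b = 0) : cross b a = 0 := by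
  rw [cross_comm_neg, h, neg_zero]

/-- joint continuity of the cross product. -/
theorem continuous_cross₂ : Continuous fun p : EuclideanSpace ℝ (Fin 3) × EuclideanSpace ℝ (Fin 3) => cross p.1 p.2 :=
  crossCLM.continuous₂

/-- the cross product of two convergent sequences converges. -/
theorem tendsto_cross {α : Type*} {l : Filter α} {f g : α → EuclideanSpace ℝ (Fin 3)} {a b : EuclideanSpace ℝ (Fin 3)}
    (hf : Tendsto f l (𝓝 a)) (hg : Tendsto g l (𝓝 b)) : Tendsto (fun n => cross (f n) (g n)) l (𝓝 (cross a b)) := by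
  have h : Tendsto (fun n => crossCLM (f n) (g n)) l (𝓝 (crossCLM a b)) :=
    ((crossCLM.continuous₂.tendsto (a, b)).comp (hf.prodMk_nhds hg) :)
  simpa only [crossCLM_apply] using h

/-- continuity of `x ↦ f x × g x`. -/
theorem continuous_cross_comp {X : Type*} [TopologicalSpace X] {f g : X → EuclideanSpace ℝ (Fin 3)} (hf : Continuous f)
    (hg : Continuous g) : Continuous fun x => cross (f x) (g x) :=
  continuous_cross₂.comp (hf.prodMk hg)

/-- the radial truncation has norm `≤ B`. -/
theorem norm_truncate_le {B : ℝ} (hB : 0 < B) (a : EuclideanSpace ℝ (Fin 3)) : ‖truncate B a‖ ≤ B := by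
  unfold truncate
  have hm : 0 < max B ‖a‖ := lt_max_of_lt_left hB
  rw [norm_smul, Real.norm_of_nonneg (div_nonneg hB.le hm.le), div_mul_eq_mul_div, div_le_iff₀ hm]
  exact mul_le_mul_of_nonneg_left (le_max_right _ _) hB.le

/-- the radial truncation is the identity on the ball of radius `B`. -/
theorem truncate_of_norm_le {B : ℝ} (hB : 0 < B) {a : EuclideanSpace ℝ (Fin 3)} (ha : ‖a‖ ≤ B) : truncate B a = a := by
  unfold truncate
  rw [max_eq_left ha, div_self hB.ne', one_smul]

/-- the radial truncation is continuous. -/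
theorem continuous_truncate {B : ℝ} (hB : 0 < B) : Continuous (truncate B) := by
  have h : Continuous fun a : EuclideanSpace ℝ (Fin 3) => B / max B ‖a‖ :=
    continuous_const.div (continuous_const.max continuous_norm) fun a => (lt_max_of_lt_left hB).ne'
  exact h.smul continuous_id

/-- off the topological support of `g` its gradient vanishes. -/
theorem gradient_eq_zero_off {g : EuclideanSpace ℝ (Fin 3) → ℝ} {x : EuclideanSpace ℝ (Fin 3)} (hx : x ∉ tsupport g) :
    gradient g x = 0 :=
  gradient_eq_zero_of_notMem_tsupport hx

/-- a test weight is `C¹`. -/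
theorem IsTestWeight.contDiff {U : Set (EuclideanSpace ℝ (Fin 3))} {g : EuclideanSpace ℝ (Fin 3) → ℝ}
    (hg : IsTestWeight U g) : ContDiff ℝ 1 g := hg.1.of_le (by simp)

/-- the gradient of a test weight is continuous. -/
theorem IsTestWeight.continuous_gradient {U : Set (EuclideanSpace ℝ (Fin 3))} {g : EuclideanSpace ℝ (Fin 3) → ℝ}
    (hg : IsTestWeight U g) : Continuous (gradient g) := continuous_gradient_of_contDiff hg.contDiff

/-- the gradient of a test weight has norm `≤ 1`. -/
theorem IsTestWeight.norm_gradient_le {U : Set (EuclideanSpace ℝ (Fin 3))} {g : EuclideanSpace ℝ (Fin 3) → ℝ}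
    (hg : IsTestWeight U g) (x : EuclideanSpace ℝ (Fin 3)) : ‖gradient g x‖ ≤ 1 := by
  rw [gradient, LinearIsometryEquiv.norm_map]
  exact (hg.2.2.2 x).2

/-- the integrand `trunc_B(F) × ∇g` is dominated by the integrable `B ‖∇g‖`. -/
theorem integrable_bound {U : Set (EuclideanSpace ℝ (Fin 3))} {g : EuclideanSpace ℝ (Fin 3) → ℝ} (hg : IsTestWeight U g)
    (B : ℝ) : Integrable (fun x => B * ‖gradient g x‖) := by
  have hc : Continuous fun x => B * ‖gradient g x‖ := continuous_const.mul hg.continuous_gradient.norm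
  refine hc.integrable_of_hasCompactSupport ?_
  refine hg.2.1.mono' fun x hx => ?_
  contrapose! hx
  simp only [mem_support, not_not]
  rw [gradient_eq_zero_off hx, norm_zero, mul_zero]


end Summit.NavierStokesRegularity.NavierStokesRegularity.Theorems.SineMomentDoor

end
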